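import Literature.Probability.RandomPlanarGeometry.HexSAWStripWidthThreeHatThirdContactAnnihilator
import HarnessLib

/-!
# The width-three strip: the FOURTH-POWER contact hat sums `Ĉ⁴` of `S₃` obey the order-`24` recurrence of the bridge sums with explicit sources —
# `Σ_r t_rĈ⁴ + 4Σ_r ṫ_rĈ³ + 6Σ_r ẗ_rĈ² + 4Σ_r t⃛_rĈ + Σ_r t⁗_rD̂ = 0` (module «WIDTH-THREE HAT FOURTH CONTACT ANNIHILATOR»)

Topic `Literature/Probability/RandomPlanarGeometry` (continues «WIDTH-THREE HAT THIRD CONTACT ANNIHILATOR» `HexSAWStripWidthThreeHatThirdContactAnnihilator.lean` —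
`W3.detY_contact_cube_annihilator` (`Σ t_rĈ³ + 3Σ ṫ_rĈ² + 3Σ ẗ_rĈ + Σ t⃛_rD̂ = 0`), `W3.hatC3D`, `W3.detYDDDot` and the derivative plumbing — and «WIDTH-THREE HAT
CONTACT ANNIHILATOR» (`W3.detYVec`, `W3.detY/detYDot/detYDDot`)).  Lane «pcv-sawmu» (CriticalPhenomena venture), a-p2 g29 — first step towards the FOURTH contact
cumulant `κ₄` of the critical width-three strip (the `T = 2` value `κ₄(T=2) = (3339420 − 2361331√2)/32` is «WIDTH-TWO CONTACT KURTOSIS»).  One more `y∂_y`: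
`y∂_yĈ³ = Ĉ⁴`, `y∂_y t⃛_r = t⁗_r`; binomial pattern `1, 4, 6, 4, 1`.  Source of the frame: W. Feller I (1968) XIII.6; nothing below is printed.

## What is proved (namespace `…SAW.HV.W3`)
* §1 `hatC4D y k` (`Ĉ⁴(k)_{ab} = Σ #top⁴·x^{#steps}y^{#top}`), `hasDerivAt_contactCubeSum_three`, `mul_derivContactCubeSum_three_eq` (`y∂_y Σ#top³wD = Σ#top⁴wD`).
* §2 `detYPolyDDDDot`, `detYDDDDot` (`t⁗_r = (y∂_y)⁴t_r = x_c^{48−2r}Σ m⁴c_{r,m}y^m`), `hasDerivAt_detYPolyDDDot`, `mul_deriv_detYPolyDDDot`, `hasDerivAt_detYDDDot`.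
* §3 ★★★ **`detY_contact_fourth_annihilator`**:
  `Σ_{r<25} t_rĈ⁴(n+1+r)_{ab} + 4Σ ṫ_rĈ³(n+1+r)_{ab} + 6Σ ẗ_rĈ²(n+1+r)_{ab} + 4Σ t⃛_rĈ(n+1+r)_{ab} + Σ t⁗_rD̂(n+1+r)_{ab} = 0` (`y > 0`).

Label: LANE THEOREM (own result of lane «pcv-sawmu», a-p2 g29, 2026-08-28; not in print).  NOT claimed: the quartic law of `Ĉ⁴` and `κ₄(T=3)` (next modules).
-/

noncomputable section

open Finset Filter Topology Matrix Literature.Probability.LatticeModels Literature.Probability.Percolation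

namespace Literature.Probability.RandomPlanarGeometry.SAW

namespace HV

namespace W3

/-! ## §1 The fourth-power contact hat sums and `y∂_y Ĉ³ = Ĉ⁴` -/

/-- The fourth-power contact hat bridge sum of `S₃`: `Ĉ⁴(k)_{ab} = Σ_{standard bridges a→b with 2k+χ_a−χ_b steps} #top⁴ · x^{#steps} y^{#top}`.
[cite: Feller1968, XIII.6; DuminilCopinHammond2013, §2.2; lane «pcv-sawmu» a-p2 g29] -/
def hatC4D (y : ℝ) (k : ℕ) : Matrix (Fin (2 * 3)) (Fin (2 * 3)) ℝ :=
  Matrix.of fun a b : Fin (2 * 3) => ∑ l ∈ LUset 3 (2 * k + 1) (hatLen k a b) (a : ℕ) (b : ℕ), (topCnt 3 l.tail : ℝ) ^ 4 * wD 3 y l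

/-- `k·y^{k−1}·y = k·y^k` for natural `k` (both sides vanish at `k = 0`; plumbing, private). [folklore] -/
private theorem natMul_pow_pred_mul_w3q (k : ℕ) (y : ℝ) : (k : ℝ) * y ^ (k - 1) * y = (k : ℝ) * y ^ k := by
  rcases Nat.eq_zero_or_pos k with h | h
  · subst h; simp
  · rw [mul_assoc, ← pow_succ, Nat.sub_add_cancel h]

/-- The cube-weighted contact sum over a finite set of words is differentiable in `y` (plumbing). [cite: DuminilCopinHammond2013, §2.2; lane plumbing] -/
theorem hasDerivAt_contactCubeSum_three (S : Finset (List HV)) (y : ℝ) :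
    HasDerivAt (fun y => ∑ l ∈ S, (topCnt 3 l.tail : ℝ) ^ 3 * wD 3 y l)
      (∑ l ∈ S, (topCnt 3 l.tail : ℝ) ^ 3 * (hexCriticalFugacity ^ (l.length - 1) * ((topCnt 3 l.tail : ℝ) * y ^ (topCnt 3 l.tail - 1)))) y := by
  unfold wD
  exact HasDerivAt.fun_sum fun l _ => ((hasDerivAt_pow _ y).const_mul _).const_mul _

/-- `y · ∂_y Σ #top³·wD = Σ #top⁴·wD` (plumbing). [cite: DuminilCopinHammond2013, §2.2; lane plumbing] -/
theorem mul_derivContactCubeSum_three_eq (S : Finset (List HV)) (y : ℝ) :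
    y * ∑ l ∈ S, (topCnt 3 l.tail : ℝ) ^ 3 * (hexCriticalFugacity ^ (l.length - 1) * ((topCnt 3 l.tail : ℝ) * y ^ (topCnt 3 l.tail - 1))) =
      ∑ l ∈ S, (topCnt 3 l.tail : ℝ) ^ 4 * wD 3 y l := by
  rw [mul_sum]
  refine sum_congr rfl fun l _ => ?_
  unfold wD
  calc y * ((topCnt 3 l.tail : ℝ) ^ 3 * (hexCriticalFugacity ^ (l.length - 1) * ((topCnt 3 l.tail : ℝ) * y ^ (topCnt 3 l.tail - 1))))
      = (topCnt 3 l.tail : ℝ) ^ 3 * hexCriticalFugacity ^ (l.length - 1) * ((topCnt 3 l.tail : ℝ) * y ^ (topCnt 3 l.tail - 1) * y) := by ring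
    _ = _ := by rw [natMul_pow_pred_mul_w3q]; ring

/-! ## §2 The fourth `y`-derivative data of `det P` -/

/-- `p⁗_r(y) = Σ_{m<8} m⁴·c_{r,m} y^m`. [cite: Feller1968, XIII.6; lane «pcv-sawmu» a-p2 g29] -/
def detYPolyDDDDot (r : ℕ) (y : ℝ) : ℝ := ∑ m : Fin 8, ((m : ℕ) : ℝ) ^ 4 * detYVec r m * y ^ (m : ℕ)

/-- `t⁗_r(y) := (y∂_y)⁴ t_r(y) = x_c^{48−2r}·p⁗_r(y)`. [cite: Feller1968, XIII.6; lane «pcv-sawmu» a-p2 g29] -/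
def detYDDDDot (y : ℝ) (r : ℕ) : ℝ := hexCriticalFugacity ^ (48 - 2 * r) * detYPolyDDDDot r y

/-- `p⃛_r` is differentiable with derivative `Σ_m m³·c_{r,m}·(m y^{m−1})` (plumbing). [cite: Feller1968, XIII.6; lane plumbing] -/
theorem hasDerivAt_detYPolyDDDot (r : ℕ) (y : ℝ) :
    HasDerivAt (detYPolyDDDot r) (∑ m : Fin 8, ((m : ℕ) : ℝ) ^ 3 * detYVec r m * (((m : ℕ) : ℝ) * y ^ ((m : ℕ) - 1))) y := by
  unfold detYPolyDDDot
  exact HasDerivAt.fun_sum fun m _ => (hasDerivAt_pow (m : ℕ) y).const_mul _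

/-- `y·p⃛_r′(y) = p⁗_r(y)` (plumbing). [cite: Feller1968, XIII.6; lane plumbing] -/
theorem mul_deriv_detYPolyDDDot (r : ℕ) (y : ℝ) :
    y * ∑ m : Fin 8, ((m : ℕ) : ℝ) ^ 3 * detYVec r m * (((m : ℕ) : ℝ) * y ^ ((m : ℕ) - 1)) = detYPolyDDDDot r y := by
  unfold detYPolyDDDDot
  rw [Finset.mul_sum]
  refine Finset.sum_congr rfl fun m _ => ?_
  rcases Nat.eq_zero_or_pos (m : ℕ) with h | h
  · rw [h]; simp
  · calc y * (((m : ℕ) : ℝ) ^ 3 * detYVec r m * (((m : ℕ) : ℝ) * y ^ ((m : ℕ) - 1)))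
        = ((m : ℕ) : ℝ) ^ 4 * detYVec r m * (y * y ^ ((m : ℕ) - 1)) := by ring
      _ = ((m : ℕ) : ℝ) ^ 4 * detYVec r m * y ^ (m : ℕ) := by rw [← pow_succ', Nat.sub_add_cancel h]

/-- `t⃛_r` is differentiable in `y` and `y·t⃛_r′ = t⁗_r` (plumbing). [cite: Feller1968, XIII.6; lane plumbing] -/
theorem hasDerivAt_detYDDDot (y : ℝ) (r : ℕ) : ∃ d : ℝ, HasDerivAt (fun y => detYDDDot y r) d y ∧ y * d = detYDDDDot y r := by
  refine ⟨hexCriticalFugacity ^ (48 - 2 * r) * ∑ m : Fin 8, ((m : ℕ) : ℝ) ^ 3 * detYVec r m * (((m : ℕ) : ℝ) * y ^ ((m : ℕ) - 1)), ?_, ?_⟩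
  · unfold detYDDDot; exact (hasDerivAt_detYPolyDDDot r y).const_mul _
  · unfold detYDDDDot; rw [← mul_deriv_detYPolyDDDot]; ring

/-! ## §3 The fourth contact annihilator -/

/-- ★★★ **The fourth contact annihilator**: for `y > 0`, all levels `a, b` and all `n`,
`Σ_{r<25} t_rĈ⁴(n+1+r)_{ab} + 4Σ_r ṫ_rĈ³ + 6Σ_r ẗ_rĈ² + 4Σ_r t⃛_rĈ + Σ_r t⁗_rD̂ = 0` — `y∂_y` of `detY_contact_cube_annihilator` (`y∂_yĈ³ = Ĉ⁴`, …,
`y∂_y t⃛ = t⁗`; binomial pattern `1, 4, 6, 4, 1`).  This closes the linear system for the first FOUR contact moments of long `S₃` bridges.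
[cite: Feller1968, XIII.6 (moments of the number of renewals by differentiating the renewal equation); Stanley2012EC1, §4.1 Theorem 4.1.1 (iii); lane «pcv-sawmu» a-p2 g29 — own result, not in print] -/
theorem detY_contact_fourth_annihilator {y : ℝ} (hy : 0 < y) (a b : Fin (2 * 3)) (n : ℕ) :
    ∑ r ∈ range 25, detY y r * hatC4D y (n + 1 + r) a b + 4 * ∑ r ∈ range 25, detYDot y r * hatC3D y (n + 1 + r) a b
      + 6 * ∑ r ∈ range 25, detYDDot y r * hatC2D y (n + 1 + r) a b + 4 * ∑ r ∈ range 25, detYDDDot y r * hatCD y (n + 1 + r) a b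
      + ∑ r ∈ range 25, detYDDDDot y r * hatD 3 y (n + 1 + r) a b = 0 := by
  -- derivative data of the five slice families
  set dU : ℕ → ℝ → ℝ := fun k y =>
    ∑ l ∈ LUset 3 (2 * k + 1) (hatLen k a b) (a : ℕ) (b : ℕ), hexCriticalFugacity ^ (l.length - 1) * ((topCnt 3 l.tail : ℝ) * y ^ (topCnt 3 l.tail - 1))
    with hdU
  set dC : ℕ → ℝ → ℝ := fun k y =>
    ∑ l ∈ LUset 3 (2 * k + 1) (hatLen k a b) (a : ℕ) (b : ℕ),
      (topCnt 3 l.tail : ℝ) * (hexCriticalFugacity ^ (l.length - 1) * ((topCnt 3 l.tail : ℝ) * y ^ (topCnt 3 l.tail - 1))) with hdC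
  set dC2 : ℕ → ℝ → ℝ := fun k y =>
    ∑ l ∈ LUset 3 (2 * k + 1) (hatLen k a b) (a : ℕ) (b : ℕ),
      (topCnt 3 l.tail : ℝ) ^ 2 * (hexCriticalFugacity ^ (l.length - 1) * ((topCnt 3 l.tail : ℝ) * y ^ (topCnt 3 l.tail - 1))) with hdC2
  set dC3 : ℕ → ℝ → ℝ := fun k y =>
    ∑ l ∈ LUset 3 (2 * k + 1) (hatLen k a b) (a : ℕ) (b : ℕ),
      (topCnt 3 l.tail : ℝ) ^ 3 * (hexCriticalFugacity ^ (l.length - 1) * ((topCnt 3 l.tail : ℝ) * y ^ (topCnt 3 l.tail - 1))) with hdC3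
  have hD : ∀ k (y : ℝ), HasDerivAt (fun y => hatD 3 y k a b) (dU k y) y := fun k y => hasDerivAt_LUs (2 * k + 1) (hatLen k a b) _ _ y
  have hC : ∀ k (y : ℝ), HasDerivAt (fun y => hatCD y k a b) (dC k y) y := fun k y => by
    simp only [hatCD, Matrix.of_apply]; exact hasDerivAt_contactSum _ y
  have hC2d : ∀ k (y : ℝ), HasDerivAt (fun y => hatC2D y k a b) (dC2 k y) y := fun k y => by
    simp only [hatC2D, Matrix.of_apply]; exact hasDerivAt_contactSqSum_three _ y
  have hC3d : ∀ k (y : ℝ), HasDerivAt (fun y => hatC3D y k a b) (dC3 k y) y := fun k y => by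
    simp only [hatC3D, Matrix.of_apply]; exact hasDerivAt_contactCubeSum_three _ y
  have hU : ∀ k, y * dU k y = hatCD y k a b := fun k => by
    rw [hdU]; simp only [hatCD, Matrix.of_apply]; exact mul_derivSum_eq_contactSum _ y
  have hC2 : ∀ k, y * dC k y = hatC2D y k a b := fun k => by
    rw [hdC]; simp only [hatC2D, Matrix.of_apply]; exact mul_derivContactSum_eq _ y
  have hC3 : ∀ k, y * dC2 k y = hatC3D y k a b := fun k => by
    rw [hdC2]; simp only [hatC3D, Matrix.of_apply]; exact mul_derivContactSqSum_three_eq _ y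
  have hC4 : ∀ k, y * dC3 k y = hatC4D y k a b := fun k => by
    rw [hdC3]; simp only [hatC4D, Matrix.of_apply]; exact mul_derivContactCubeSum_three_eq _ y
  choose dT hdT hTdot using fun r => hasDerivAt_detY y r
  choose dTd hdTd hTddot using fun r => hasDerivAt_detYDot y r
  choose dTdd hdTdd hTdddot using fun r => hasDerivAt_detYDDot y r
  choose dTddd hdTddd hTddddot using fun r => hasDerivAt_detYDDDot y r
  set F : ℝ → ℝ := fun y => ∑ r ∈ range 25, detY y r * hatC3D y (n + 1 + r) a b + 3 * ∑ r ∈ range 25, detYDot y r * hatC2D y (n + 1 + r) a b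
      + 3 * ∑ r ∈ range 25, detYDDot y r * hatCD y (n + 1 + r) a b + ∑ r ∈ range 25, detYDDDot y r * hatD 3 y (n + 1 + r) a b with hF
  have hFd : HasDerivAt F (∑ r ∈ range 25, (dT r * hatC3D y (n + 1 + r) a b + detY y r * dC3 (n + 1 + r) y)
      + 3 * ∑ r ∈ range 25, (dTd r * hatC2D y (n + 1 + r) a b + detYDot y r * dC2 (n + 1 + r) y)
      + 3 * ∑ r ∈ range 25, (dTdd r * hatCD y (n + 1 + r) a b + detYDDot y r * dC (n + 1 + r) y)
      + ∑ r ∈ range 25, (dTddd r * hatD 3 y (n + 1 + r) a b + detYDDDot y r * dU (n + 1 + r) y)) y := by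
    rw [hF]
    exact (((HasDerivAt.fun_sum fun r _ => (hdT r).mul (hC3d (n + 1 + r) y)).add
      ((HasDerivAt.fun_sum fun r _ => (hdTd r).mul (hC2d (n + 1 + r) y)).const_mul 3)).add
      ((HasDerivAt.fun_sum fun r _ => (hdTdd r).mul (hC (n + 1 + r) y)).const_mul 3)).add
      (HasDerivAt.fun_sum fun r _ => (hdTddd r).mul (hD (n + 1 + r) y))
  have hF0 : F =ᶠ[𝓝 y] fun _ => (0 : ℝ) := by
    filter_upwards [Ioi_mem_nhds hy] with y' hy'
    rw [hF]; exact detY_contact_cube_annihilator hy' a b n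
  have hzero := (hFd.congr_of_eventuallyEq hF0.symm).unique (hasDerivAt_const y (0 : ℝ))
  have hmul : y * (∑ r ∈ range 25, (dT r * hatC3D y (n + 1 + r) a b + detY y r * dC3 (n + 1 + r) y)
      + 3 * ∑ r ∈ range 25, (dTd r * hatC2D y (n + 1 + r) a b + detYDot y r * dC2 (n + 1 + r) y)
      + 3 * ∑ r ∈ range 25, (dTdd r * hatCD y (n + 1 + r) a b + detYDDot y r * dC (n + 1 + r) y)
      + ∑ r ∈ range 25, (dTddd r * hatD 3 y (n + 1 + r) a b + detYDDDot y r * dU (n + 1 + r) y))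
      = ∑ r ∈ range 25, detY y r * hatC4D y (n + 1 + r) a b + 4 * ∑ r ∈ range 25, detYDot y r * hatC3D y (n + 1 + r) a b
        + 6 * ∑ r ∈ range 25, detYDDot y r * hatC2D y (n + 1 + r) a b + 4 * ∑ r ∈ range 25, detYDDDot y r * hatCD y (n + 1 + r) a b
        + ∑ r ∈ range 25, detYDDDDot y r * hatD 3 y (n + 1 + r) a b := by
    simp only [mul_add, Finset.mul_sum, ← Finset.sum_add_distrib]
    refine Finset.sum_congr rfl fun r _ => ?_
    rw [← hU (n + 1 + r), ← hC2 (n + 1 + r), ← hC3 (n + 1 + r), ← hC4 (n + 1 + r), ← hTdot r, ← hTddot r, ← hTdddot r, ← hTddddot r]; ring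
  rw [← hmul, hzero, mul_zero]

end W3

end HV

end Literature.Probability.RandomPlanarGeometry.SAW
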